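import Summits.NavierStokesRegularity.NavierStokesRegularity.Theorems.PerpetualPumpAveragedTypeIBlowupDieGlobalTools

/-!
# Crux `PerpetualPump.AveragedTypeIBlowup` (stmt-NavierStokesRegularity-1835), line `Sketch`:
# the stub `dieGlobal` — uniqueness and gluing for the Volterra chain

T. Tao, *Finite time blowup for an averaged three-dimensional Navier–Stokes equation*, J. Amer.
Math. Soc. **29** (2016), 601–674 = arXiv:1402.0290v3, §4 p. 22 (4.14): the wavelet coefficients of
a mild solution of the cascade equation solve the exact Volterra chain
`Y_{i,n}(t) = A 1_{(i,n)=(i₀,n₀)} k_{i,n}(t) + ∫₀ᵗ k_{i,n}(t-s) quadTerm(Y)_{i,n}(s) ds`, `|k_{i,n}| ≤ 1`.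

Helper file (theorems only) for the registered stub `stub_dieGlobal` of the lead's skeleton
`Cruxes/AveragedTypeIBlowup/Lines/Sketch.lean`: the bookkeeping half of the globalization.

* `chain_unique` (the registered sub-goal `stub_dieGlobalUnique`): two continuous solutions of the
  chain from time `0` (continuous kernels `|k| ≤ 1`, no modes below `n₀`, `(1+ε₀)^{20n}`-bounded on
  compact sub-intervals) agree on their common domain — an exponentially time-weighted supremum of the
  weighted difference improves itself by a factor `½` (weighted Lipschitz bound of the drive,
  `abs_quadTerm_sub_le_of_weight`, and `∫₀ˢ e^{γu} du ≤ e^{γs}/γ`), so it vanishes;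
* `chain_glue`: solutions on the lifespans of a nonempty set of reals glue to one solution up to the
  supremum of the set.

Nothing here closes the item (`--supports`); no statement of the route changes.

## References

* T. Tao, J. Amer. Math. Soc. 29 (2016), 601–674, arXiv:1402.0290v3, §4 p. 22 (4.14).
  [`Tao2016AveragedNS`]
-/

noncomputable section

-- the summit namespace `…NavierStokesRegularity.NavierStokesRegularity…` is the tree convention
set_option linter.dupNamespace false

open MeasureTheory Set Filter Topology
open scoped ENNReal
open Literature.Analysis.FluidPDE
open Literature.Analysis.FluidPDE.TaoCascade (quadTerm shiftSet mem_shiftSet_iff)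

namespace Summit.NavierStokesRegularity.NavierStokesRegularity.Theorems.PerpetualPumpAveragedTypeIBlowup

variable {ε₀ : ℝ} {m : ℕ}

/-! ### Uniqueness of the chain from time `0` -/

/-- **Uniqueness for the Volterra chain.** Two continuous solutions of
`Y_{i,n}(t) = A 1_{(i,n)=(i₀,n₀)} k_{i,n}(t) + ∫₀ᵗ k_{i,n}(t-s) quadTerm(Y)_{i,n}(s) ds` (continuous kernels
`|k_{i,n}| ≤ 1`) on `[0,S₁)` and `[0,S₂)`, without modes below `n₀` and `(1+ε₀)^{20n}`-bounded on compact
sub-intervals, agree on `[0, min(S₁,S₂))`. On `[0,b]` both have weighted size `ρ`; with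
`Λ = 2Kρ(1+ε₀)^{75/2-35n₀/2}` and `γ = 2Λ+1`, the supremum `D` of
`e^{-γs}(1+ε₀)^{20k}|Y₁-Y₂|(s)` over `[0,b]` and all modes obeys `D ≤ (Λ/γ)D ≤ D/2` by the weighted
Lipschitz bound of the drive and `∫₀ˢ e^{γu} du ≤ e^{γs}/γ`, so `D = 0`. [cite: Tao2016AveragedNS, §4 p. 22 (4.14)] -/
theorem chain_unique (hε₀ : 0 < ε₀) (α : Fin m → Fin m → Fin m → ℤ × ℤ × ℤ → ℝ)
    (k : Fin m → ℤ → ℝ → ℝ) (hka : ∀ i n τ, |k i n τ| ≤ 1) (hkc : ∀ i n, Continuous (k i n))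
    (i₀ : Fin m) (n₀ : ℤ) (A : ℝ) {S₁ S₂ : ℝ} {Y₁ Y₂ : Fin m → ℤ → ℝ → ℝ}
    (hc₁ : ∀ i n, ContinuousOn (Y₁ i n) (Ico 0 S₁)) (hl₁ : ∀ i n t, n < n₀ → Y₁ i n t = 0)
    (hd₁ : ∀ S' : ℝ, S' < S₁ → ∃ C : ℝ, ∀ (i : Fin m) (n : ℤ), ∀ t ∈ Icc 0 S',
      (1 + ε₀) ^ ((20 : ℝ) * n) * |Y₁ i n t| ≤ C)
    (hch₁ : ∀ (i : Fin m) (n : ℤ), ∀ t ∈ Ico 0 S₁,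
      Y₁ i n t = (if i = i₀ ∧ n = n₀ then A else 0) * k i n t +
        ∫ s in (0 : ℝ)..t, k i n (t - s) * quadTerm ε₀ α Y₁ i n s)
    (hc₂ : ∀ i n, ContinuousOn (Y₂ i n) (Ico 0 S₂)) (hl₂ : ∀ i n t, n < n₀ → Y₂ i n t = 0)
    (hd₂ : ∀ S' : ℝ, S' < S₂ → ∃ C : ℝ, ∀ (i : Fin m) (n : ℤ), ∀ t ∈ Icc 0 S',
      (1 + ε₀) ^ ((20 : ℝ) * n) * |Y₂ i n t| ≤ C)
    (hch₂ : ∀ (i : Fin m) (n : ℤ), ∀ t ∈ Ico 0 S₂,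
      Y₂ i n t = (if i = i₀ ∧ n = n₀ then A else 0) * k i n t +
        ∫ s in (0 : ℝ)..t, k i n (t - s) * quadTerm ε₀ α Y₂ i n s) :
    ∀ (i : Fin m) (n : ℤ), ∀ t ∈ Ico 0 (min S₁ S₂), Y₁ i n t = Y₂ i n t := by
  intro i n b hb
  have hL0 : 0 < 1 + ε₀ := by linarith
  have hL1 : 1 ≤ 1 + ε₀ := by linarith
  obtain ⟨hb0, hbS⟩ := hb
  have hb₁ : b < S₁ := lt_of_lt_of_le hbS (min_le_left _ _)
  have hb₂ : b < S₂ := lt_of_lt_of_le hbS (min_le_right _ _)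
  obtain ⟨C₁, hC₁⟩ := hd₁ b hb₁
  obtain ⟨C₂, hC₂⟩ := hd₂ b hb₂
  set ρ : ℝ := max C₁ C₂ with hρ
  have hρ0 : 0 ≤ ρ := le_max_of_le_left
    (le_trans (mul_nonneg (Real.rpow_nonneg hL0.le _) (abs_nonneg _)) (hC₁ i n 0 ⟨le_rfl, hb0⟩))
  have hY₁ : ∀ s ∈ Icc 0 b, ∀ (j : Fin m) (k' : ℤ), |Y₁ j k' s| ≤ ρ * (1 + ε₀) ^ (-((20 : ℝ) * k')) :=
    fun s hs j k' => (weight_mul_abs_le_iff hL0 _ _ _).1 ((hC₁ j k' s hs).trans (le_max_left _ _))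
  have hY₂ : ∀ s ∈ Icc 0 b, ∀ (j : Fin m) (k' : ℤ), |Y₂ j k' s| ≤ ρ * (1 + ε₀) ^ (-((20 : ℝ) * k')) :=
    fun s hs j k' => (weight_mul_abs_le_iff hL0 _ _ _).1 ((hC₂ j k' s hs).trans (le_max_right _ _))
  set K : ℝ := ∑ i₃ : Fin m, ∑ i₁ : Fin m, ∑ i₂ : Fin m, ∑ μ ∈ shiftSet, |α i₁ i₂ i₃ μ| with hK
  have hK0 : 0 ≤ K := by positivity
  have hKall : ∀ j : Fin m, (∑ i₁ : Fin m, ∑ i₂ : Fin m, ∑ μ ∈ shiftSet, |α i₁ i₂ j μ|) ≤ K :=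
    fun j => coeffSum_le α j
  clear_value K
  set Λ : ℝ := K * (2 * ρ) * (1 + ε₀) ^ ((75 : ℝ) / 2 - (35 : ℝ) / 2 * n₀) with hΛ
  have hΛ0 : 0 ≤ Λ := by positivity
  clear_value Λ
  set γ : ℝ := 2 * Λ + 1 with hγ
  have hγ0 : 0 < γ := by rw [hγ]; positivity
  have hΛγ : Λ / γ ≤ 1 / 2 := by
    rw [div_le_iff₀ hγ0, hγ]
    linarith
  clear_value γ
  -- the weighted supremum of the difference over `[0, b]` and all modes
  set V : Set ℝ := {x | ∃ (j : Fin m) (k' : ℤ) (s : ℝ), s ∈ Icc 0 b ∧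
    x = Real.exp (-(γ * s)) * ((1 + ε₀) ^ ((20 : ℝ) * k') * |Y₁ j k' s - Y₂ j k' s|)} with hV
  have hVbdd : BddAbove V := by
    refine ⟨2 * ρ, ?_⟩
    rintro x ⟨j, k', s, hs, rfl⟩
    have h1 : Real.exp (-(γ * s)) ≤ 1 := Real.exp_le_one_iff.2 (by nlinarith [hs.1, hγ0])
    have h2 : (1 + ε₀) ^ ((20 : ℝ) * k') * |Y₁ j k' s - Y₂ j k' s| ≤ 2 * ρ := by
      calc (1 + ε₀) ^ ((20 : ℝ) * k') * |Y₁ j k' s - Y₂ j k' s|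
          ≤ (1 + ε₀) ^ ((20 : ℝ) * k') * (|Y₁ j k' s| + |Y₂ j k' s|) :=
            mul_le_mul_of_nonneg_left (abs_sub _ _) (Real.rpow_nonneg hL0.le _)
        _ ≤ ρ + ρ := by
            rw [mul_add]
            exact add_le_add ((hC₁ j k' s hs).trans (le_max_left _ _))
              ((hC₂ j k' s hs).trans (le_max_right _ _))
        _ = 2 * ρ := by ring
    calc Real.exp (-(γ * s)) * ((1 + ε₀) ^ ((20 : ℝ) * k') * |Y₁ j k' s - Y₂ j k' s|) ≤ 1 * (2 * ρ) :=
          mul_le_mul h1 h2 (mul_nonneg (Real.rpow_nonneg hL0.le _) (abs_nonneg _)) zero_le_one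
      _ = 2 * ρ := one_mul _
  have hVne : V.Nonempty := ⟨_, i, n, b, ⟨hb0, le_rfl⟩, rfl⟩
  have hDub : ∀ (j : Fin m) (k' : ℤ) (s : ℝ), s ∈ Icc 0 b →
      Real.exp (-(γ * s)) * ((1 + ε₀) ^ ((20 : ℝ) * k') * |Y₁ j k' s - Y₂ j k' s|) ≤ sSup V :=
    fun j k' s hs => le_csSup hVbdd ⟨j, k', s, hs, rfl⟩
  have hD0 : 0 ≤ sSup V :=
    le_trans (mul_nonneg (Real.exp_pos _).le (mul_nonneg (Real.rpow_nonneg hL0.le _) (abs_nonneg _)))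
      (hDub i n b ⟨hb0, le_rfl⟩)
  -- the difference in the weight `20`, pointwise in time
  have hdiff : ∀ u ∈ Icc 0 b, ∀ (j : Fin m) (k' : ℤ),
      |Y₁ j k' u - Y₂ j k' u| ≤ sSup V * Real.exp (γ * u) * (1 + ε₀) ^ (-((20 : ℝ) * k')) := by
    intro u hu j k'
    have h := hDub j k' u hu
    rw [Real.exp_neg, inv_mul_le_iff₀ (Real.exp_pos _), mul_comm (Real.exp _)] at h
    exact (weight_mul_abs_le_iff hL0 _ _ _).1 h
  -- every element of `V` is at most half the supremum
  have hhalf : ∀ x ∈ V, x ≤ sSup V / 2 := by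
    rintro x ⟨j, k', s, hs, rfl⟩
    rcases lt_or_ge k' n₀ with hk' | hk'
    · rw [hl₁ j k' s hk', hl₂ j k' s hk', sub_zero, abs_zero, mul_zero, mul_zero]
      positivity
    have hs₁ : s ∈ Ico 0 S₁ := ⟨hs.1, hs.2.trans_lt hb₁⟩
    have hs₂ : s ∈ Ico 0 S₂ := ⟨hs.1, hs.2.trans_lt hb₂⟩
    have hInt : ∀ {Z : Fin m → ℤ → ℝ → ℝ} {T : ℝ}, (∀ i n, ContinuousOn (Z i n) (Ico 0 T)) → s < T →
        IntervalIntegrable (fun u => k j k' (s - u) * quadTerm ε₀ α Z j k' u) volume 0 s :=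
      fun hZ hsT => ((((hkc j k').comp (continuous_const.sub continuous_id)).continuousOn).mul
        ((quadTerm_continuousOn α hZ j k').mono (by
          rw [uIcc_of_le hs.1]
          exact fun u hu => ⟨hu.1, hu.2.trans_lt hsT⟩))).intervalIntegrable
    have hsub : Y₁ j k' s - Y₂ j k' s = ∫ u in (0 : ℝ)..s,
        (k j k' (s - u) * quadTerm ε₀ α Y₁ j k' u - k j k' (s - u) * quadTerm ε₀ α Y₂ j k' u) := by
      rw [hch₁ j k' s hs₁, hch₂ j k' s hs₂, add_sub_add_left_eq_sub,
        intervalIntegral.integral_sub (hInt hc₁ hs₁.2) (hInt hc₂ hs₂.2)]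
    set c : ℝ := (∑ i₁ : Fin m, ∑ i₂ : Fin m, ∑ μ ∈ shiftSet, |α i₁ i₂ j μ|) * (2 * ρ * sSup V) *
      (1 + ε₀) ^ ((2 * 20 - 5 / 2 : ℝ) * (1 - k')) with hc
    have hc0 : 0 ≤ c := by positivity
    have hbound : |Y₁ j k' s - Y₂ j k' s| ≤ ∫ u in (0 : ℝ)..s, c * Real.exp (γ * u) := by
      rw [hsub, ← Real.norm_eq_abs]
      refine intervalIntegral.norm_integral_le_of_norm_le hs.1 (Eventually.of_forall fun u hu => ?_) ?_
      · have hu' : u ∈ Icc 0 b := ⟨hu.1.le, hu.2.trans hs.2⟩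
        rw [Real.norm_eq_abs, ← mul_sub, abs_mul]
        have hq := abs_quadTerm_sub_le_of_weight hε₀ (by norm_num : (5 : ℝ) / 4 ≤ 20) α hρ0
          (by positivity : 0 ≤ sSup V * Real.exp (γ * u)) (hY₁ u hu') (hY₂ u hu')
          (fun j'' k'' => hdiff u hu' j'' k'') j k'
        calc |k j k' (s - u)| * |quadTerm ε₀ α Y₁ j k' u - quadTerm ε₀ α Y₂ j k' u|
            ≤ 1 * ((∑ i₁ : Fin m, ∑ i₂ : Fin m, ∑ μ ∈ shiftSet, |α i₁ i₂ j μ|) *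
                (2 * ρ * (sSup V * Real.exp (γ * u))) * (1 + ε₀) ^ ((2 * 20 - 5 / 2 : ℝ) * (1 - k'))) :=
              mul_le_mul (hka _ _ _) hq (abs_nonneg _) zero_le_one
          _ = c * Real.exp (γ * u) := by rw [hc]; ring
      · exact (continuous_const.mul (Real.continuous_exp.comp (continuous_const.mul continuous_id))).intervalIntegrable _ _
    have hexp : (1 + ε₀) ^ ((20 : ℝ) * k') * (1 + ε₀) ^ ((2 * 20 - 5 / 2 : ℝ) * (1 - k')) ≤
        (1 + ε₀) ^ ((75 : ℝ) / 2 - (35 : ℝ) / 2 * n₀) := by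
      rw [← Real.rpow_add hL0]
      refine Real.rpow_le_rpow_of_exponent_le hL1 ?_
      have hn' : (n₀ : ℝ) ≤ k' := by exact_mod_cast hk'
      linarith
    have hee : Real.exp (-(γ * s)) * Real.exp (γ * s) = 1 := by
      rw [Real.exp_neg, inv_mul_cancel₀ (Real.exp_pos _).ne']
    calc Real.exp (-(γ * s)) * ((1 + ε₀) ^ ((20 : ℝ) * k') * |Y₁ j k' s - Y₂ j k' s|)
        ≤ Real.exp (-(γ * s)) * ((1 + ε₀) ^ ((20 : ℝ) * k') * (c * (Real.exp (γ * s) / γ))) := by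
          refine mul_le_mul_of_nonneg_left (mul_le_mul_of_nonneg_left (hbound.trans ?_)
            (Real.rpow_nonneg hL0.le _)) (Real.exp_pos _).le
          rw [intervalIntegral.integral_const_mul]
          exact mul_le_mul_of_nonneg_left (integral_exp_mul_le 0 s hγ0) hc0
      _ = ((1 + ε₀) ^ ((20 : ℝ) * k') * (1 + ε₀) ^ ((2 * 20 - 5 / 2 : ℝ) * (1 - k'))) *
            ((∑ i₁ : Fin m, ∑ i₂ : Fin m, ∑ μ ∈ shiftSet, |α i₁ i₂ j μ|) * (2 * ρ)) / γ *
            (Real.exp (-(γ * s)) * Real.exp (γ * s)) * sSup V := by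
          rw [hc]
          field_simp
      _ ≤ (1 + ε₀) ^ ((75 : ℝ) / 2 - (35 : ℝ) / 2 * n₀) * (K * (2 * ρ)) / γ * 1 * sSup V := by
          rw [hee]
          gcongr
          exact hKall j
      _ = Λ / γ * sSup V := by rw [hΛ]; ring
      _ ≤ 1 / 2 * sSup V := mul_le_mul_of_nonneg_right hΛγ hD0
      _ = sSup V / 2 := by ring
  have hDle : sSup V ≤ sSup V / 2 := csSup_le hVne hhalf
  have hD : sSup V = 0 := le_antisymm (by linarith) hD0
  have h := hDub i n b ⟨hb0, le_rfl⟩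
  rw [hD] at h
  by_contra hne
  have hpos : 0 < Real.exp (-(γ * b)) * ((1 + ε₀) ^ ((20 : ℝ) * n) * |Y₁ i n b - Y₂ i n b|) :=
    mul_pos (Real.exp_pos _) (mul_pos (Real.rpow_pos_of_pos hL0 _) (abs_pos.2 (sub_ne_zero.2 hne)))
  linarith

/-! ### Gluing solutions up to the supremum of their lifespans -/

/-- **Gluing.** If for every `T` in a nonempty set `𝒯` of reals the chain (continuous kernels
`|k_{i,n}| ≤ 1`, datum `A 1_{(i,n)=(i₀,n₀)}`) has a continuous solution on `[0,T)` without modes below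
`n₀` and `(1+ε₀)^{20n}`-bounded on compact sub-intervals, then it has one on `[0, sup 𝒯)`: by
`chain_unique` the solutions agree wherever they are jointly defined, so `Y(t) :=` (the solution of any
lifespan `> t`)`(t)` is well defined and inherits continuity, the bounds and the chain identity from the
solutions it locally coincides with. [cite: Tao2016AveragedNS, §4 p. 22 (4.14)] -/
theorem chain_glue (hε₀ : 0 < ε₀) (α : Fin m → Fin m → Fin m → ℤ × ℤ × ℤ → ℝ)
    (k : Fin m → ℤ → ℝ → ℝ) (hka : ∀ i n τ, |k i n τ| ≤ 1) (hkc : ∀ i n, Continuous (k i n))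
    (i₀ : Fin m) (n₀ : ℤ) (A : ℝ) {𝒯 : Set ℝ} (hne : 𝒯.Nonempty)
    (hsol : ∀ T ∈ 𝒯, ∃ Y' : Fin m → ℤ → ℝ → ℝ,
      (∀ i n, ContinuousOn (Y' i n) (Ico 0 T)) ∧ (∀ i n t, n < n₀ → Y' i n t = 0) ∧
      (∀ S' : ℝ, S' < T → ∃ C : ℝ, ∀ (i : Fin m) (n : ℤ), ∀ t ∈ Icc 0 S',
        (1 + ε₀) ^ ((20 : ℝ) * n) * |Y' i n t| ≤ C) ∧
      (∀ (i : Fin m) (n : ℤ), ∀ t ∈ Ico 0 T,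
        Y' i n t = (if i = i₀ ∧ n = n₀ then A else 0) * k i n t +
          ∫ s in (0 : ℝ)..t, k i n (t - s) * quadTerm ε₀ α Y' i n s)) :
    ∃ Y : Fin m → ℤ → ℝ → ℝ,
      (∀ i n, ContinuousOn (Y i n) (Ico 0 (sSup 𝒯))) ∧ (∀ i n t, n < n₀ → Y i n t = 0) ∧
      (∀ S' : ℝ, S' < sSup 𝒯 → ∃ C : ℝ, ∀ (i : Fin m) (n : ℤ), ∀ t ∈ Icc 0 S',
        (1 + ε₀) ^ ((20 : ℝ) * n) * |Y i n t| ≤ C) ∧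
      (∀ (i : Fin m) (n : ℤ), ∀ t ∈ Ico 0 (sSup 𝒯),
        Y i n t = (if i = i₀ ∧ n = n₀ then A else 0) * k i n t +
          ∫ s in (0 : ℝ)..t, k i n (t - s) * quadTerm ε₀ α Y i n s) := by
  -- below `sup 𝒯` there are solutions
  have hex : ∀ t : ℝ, t < sSup 𝒯 → ∃ (T : ℝ) (Y' : Fin m → ℤ → ℝ → ℝ), t < T ∧
      (∀ i n, ContinuousOn (Y' i n) (Ico 0 T)) ∧ (∀ i n t, n < n₀ → Y' i n t = 0) ∧
      (∀ S' : ℝ, S' < T → ∃ C : ℝ, ∀ (i : Fin m) (n : ℤ), ∀ t ∈ Icc 0 S',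
        (1 + ε₀) ^ ((20 : ℝ) * n) * |Y' i n t| ≤ C) ∧
      (∀ (i : Fin m) (n : ℤ), ∀ t ∈ Ico 0 T,
        Y' i n t = (if i = i₀ ∧ n = n₀ then A else 0) * k i n t +
          ∫ s in (0 : ℝ)..t, k i n (t - s) * quadTerm ε₀ α Y' i n s) := by
    intro t ht
    obtain ⟨T, hT, htT⟩ := exists_lt_of_lt_csSup hne ht
    obtain ⟨Y', hc, hl, hd, hch⟩ := hsol T hT
    exact ⟨T, Y', htT, hc, hl, hd, hch⟩
  choose! Tof Yof hTof hcof hlof hdof hchof using hex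
  -- the glued family
  obtain ⟨Y, hY⟩ : ∃ Y : Fin m → ℤ → ℝ → ℝ, ∀ i n t,
      Y i n t = if n < n₀ then 0 else Yof t i n t := ⟨_, fun _ _ _ => rfl⟩
  have hgof : ∀ t : ℝ, t < sSup 𝒯 → ∀ (i : Fin m) (n : ℤ), ∀ s ∈ Ico 0 (min (Tof t) (sSup 𝒯)),
      Y i n s = Yof t i n s := by
    intro t ht i n s hs
    have hsT : s < Tof t := lt_of_lt_of_le hs.2 (min_le_left _ _)
    have hsT₁ : s < sSup 𝒯 := lt_of_lt_of_le hs.2 (min_le_right _ _)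
    rw [hY]
    split_ifs with hn
    · exact (hlof t ht i n s hn).symm
    · exact chain_unique hε₀ α k hka hkc i₀ n₀ A (hcof s hsT₁) (hlof s hsT₁) (hdof s hsT₁)
        (hchof s hsT₁) (hcof t ht) (hlof t ht) (hdof t ht) (hchof t ht) i n s
        ⟨hs.1, lt_min (hTof s hsT₁) hsT⟩
  refine ⟨Y, fun i n t ht => ?_, fun i n t hn => by rw [hY, if_pos hn], fun S' hS' => ?_,
    fun i n t ht => ?_⟩
  · -- continuity at `t < sup 𝒯`: `Y = Yof t` on a neighbourhood of `t` in `[0, sup 𝒯)`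
    have htT := hTof t ht.2
    have hmem : Ico 0 (min (Tof t) (sSup 𝒯)) ∈ 𝓝[Ico 0 (sSup 𝒯)] t :=
      mem_of_superset (inter_mem_nhdsWithin (Ico 0 (sSup 𝒯)) (Iio_mem_nhds htT))
        fun s hs => ⟨hs.1.1, lt_min hs.2 hs.1.2⟩
    have h1 : ContinuousWithinAt (Yof t i n) (Ico 0 (sSup 𝒯)) t :=
      ((hcof t ht.2 i n) t ⟨ht.1, htT⟩).mono_of_mem_nhdsWithin
        (mem_of_superset hmem (Ico_subset_Ico_right (min_le_left _ _)))
    exact h1.congr_of_eventuallyEq (eventuallyEq_of_mem hmem fun s hs => hgof t ht.2 i n s hs)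
      (hgof t ht.2 i n t ⟨ht.1, lt_min htT ht.2⟩)
  · -- the weight-`20` bound on `[0, S']`
    have hT' := hTof S' hS'
    obtain ⟨C, hC⟩ := hdof S' hS' S' hT'
    refine ⟨C, fun i n t ht => ?_⟩
    rw [hgof S' hS' i n t ⟨ht.1, lt_min (ht.2.trans_lt hT') (ht.2.trans_lt hS')⟩]
    exact hC i n t ht
  · -- the chain identity at `t < sup 𝒯`
    have htT := hTof t ht.2
    rw [hgof t ht.2 i n t ⟨ht.1, lt_min htT ht.2⟩, hchof t ht.2 i n t ⟨ht.1, htT⟩]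
    congr 1
    refine intervalIntegral.integral_congr fun s hs => ?_
    rw [uIcc_of_le ht.1] at hs
    show k i n (t - s) * quadTerm ε₀ α (Yof t) i n s = k i n (t - s) * quadTerm ε₀ α Y i n s
    rw [quadTerm_congr_at α (fun j k' =>
      (hgof t ht.2 j k' s ⟨hs.1, hs.2.trans_lt (lt_min htT ht.2)⟩).symm) i n]

/-! ### The registered sub-goal -/

/-- **Registered sub-goal `stub_dieGlobalUnique` of the stub `dieGlobal`** (`chain_unique`, closed
form): two continuous solutions of the Volterra chain from time `0` with the same datum (continuous
kernels `|k_{i,n}| ≤ 1`, no modes below `n₀`, `(1+ε₀)^{20n}`-bounded on compact sub-intervals) agree on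
their common domain `[0, min(S₁,S₂))`. [cite: Tao2016AveragedNS, §4 p. 22 (4.14)] -/
theorem stub_dieGlobalUnique :
    ∀ {ε₀ : ℝ}, 0 < ε₀ → ∀ {m : ℕ} (α : Fin m → Fin m → Fin m → ℤ × ℤ × ℤ → ℝ)
      (k : Fin m → ℤ → ℝ → ℝ), (∀ i n τ, |k i n τ| ≤ 1) → (∀ i n, Continuous (k i n)) →
      ∀ (i₀ : Fin m) (n₀ : ℤ) (A S₁ S₂ : ℝ) (Y₁ Y₂ : Fin m → ℤ → ℝ → ℝ),
      (∀ i n, ContinuousOn (Y₁ i n) (Ico 0 S₁)) → (∀ i n t, n < n₀ → Y₁ i n t = 0) →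
      (∀ S' : ℝ, S' < S₁ → ∃ C : ℝ, ∀ (i : Fin m) (n : ℤ), ∀ t ∈ Icc 0 S',
        (1 + ε₀) ^ ((20 : ℝ) * n) * |Y₁ i n t| ≤ C) →
      (∀ (i : Fin m) (n : ℤ), ∀ t ∈ Ico 0 S₁,
        Y₁ i n t = (if i = i₀ ∧ n = n₀ then A else 0) * k i n t +
          ∫ s in (0 : ℝ)..t, k i n (t - s) * quadTerm ε₀ α Y₁ i n s) →
      (∀ i n, ContinuousOn (Y₂ i n) (Ico 0 S₂)) → (∀ i n t, n < n₀ → Y₂ i n t = 0) →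
      (∀ S' : ℝ, S' < S₂ → ∃ C : ℝ, ∀ (i : Fin m) (n : ℤ), ∀ t ∈ Icc 0 S',
        (1 + ε₀) ^ ((20 : ℝ) * n) * |Y₂ i n t| ≤ C) →
      (∀ (i : Fin m) (n : ℤ), ∀ t ∈ Ico 0 S₂,
        Y₂ i n t = (if i = i₀ ∧ n = n₀ then A else 0) * k i n t +
          ∫ s in (0 : ℝ)..t, k i n (t - s) * quadTerm ε₀ α Y₂ i n s) →
      ∀ (i : Fin m) (n : ℤ), ∀ t ∈ Ico 0 (min S₁ S₂), Y₁ i n t = Y₂ i n t :=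
  fun hε₀ _ α k hka hkc i₀ n₀ A _ _ _ _ hc₁ hl₁ hd₁ hch₁ hc₂ hl₂ hd₂ hch₂ =>
    chain_unique hε₀ α k hka hkc i₀ n₀ A hc₁ hl₁ hd₁ hch₁ hc₂ hl₂ hd₂ hch₂

end Summit.NavierStokesRegularity.NavierStokesRegularity.Theorems.PerpetualPumpAveragedTypeIBlowup

end
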